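import Mathlib
import Summits.Ventures.PercRepro2.Harris
import Summits.Ventures.PercRepro2.BasePrime
import Summits.Ventures.PercRepro2.LocRows
import Summits.Ventures.PercRepro2.SwRow
import Summits.Ventures.PercRepro2.SwOutCube
import Summits.Ventures.PercRepro2.SwOutMixedCubeFarDefs

/-!
# The abstract big block: vocabulary and the two embedded cubes (blind cell PercRepro2, night-4
g17, 2026-08-27; proofs/NIGHT4-G17.md §4″–§4‴)

The big block of the mixed single junction with a single-vertex dropped piece `P` lives on the raw
cube of colour classes around the mixed one-sided point: a point is `(s, a, uP, e, f)` — `s` the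
u-arms (red = `true`), `a` the h-piece `A`, `uP` the u–P edges, `e` the outside edges of `P` BLUE,
`f` the far arms.  The red edge set is `{U_j : s_j} ∪ {u : ∃ j, s_j} ∪ {A : a} ∪ {P : (∃ j, s_j) ∧ uP}
∪ {F_k : f_k}` (`ER`), the blue set is the red set of the flipped point (`EB`), and the LEAKING points
(`P` in the hull of `h` with its outside edges of the hull's colour) are not configurations of the
class.  The conditioning `Q` is a lower set of the cube with the property `G4`: at `s = ⊥` and
`e = false` it does not depend on `uP` (the u–P edges are the only red edges at a blue `u`).

This file: the vocabulary (`Pt`, `Atom`, `ER`, `EB`, `Leak`, `C0`, `D`, `G4`), the splitting of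
the non-leaking points into the CANONICAL points `C0 = {uP = e}` and the ESCAPING points
`D = {s = const e, uP = !e}` (`not_leak_iff`, `not_C0_and_D`), the monotonicity of the red set
(`ER_mono`), and the two embedded cubes: `canon : Config (ι ⊕ (Fin 2 ⊕ κ)) → Pt` onto `C0`
(injective, monotone, commuting with the flips) and `esc : Config (Fin 2 ⊕ κ) → Pt` onto `D`
(injective, red set monotone, commuting with the flips, and pulling a lower set with `G4` back to
a lower set — `esc_preimage_isLowerSet`).  The counting and the theorem `bigBlock_card_le` are in
`SwOutBigBlockCube`.
-/

namespace Summit.Ventures.PercRepro2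

namespace BigBlock

open scoped Classical

variable {ι κ : Type*} [Fintype ι] [DecidableEq ι] [Fintype κ] [DecidableEq κ]

/-- A point of the raw cube: `(s, a, uP, e, f)`. -/
abbrev Pt (ι κ : Type*) := Config ι × Bool × Bool × Bool × Config κ

/-- The atoms: the u-arms, then `u`, `A`, `P`, then the far arms. -/
abbrev Atom (ι κ : Type*) := ι ⊕ (Fin 3 ⊕ κ)

/-- The atom `u`. -/
def uA : Atom ι κ := Sum.inr (Sum.inl 0)

/-- The atom `A` (the h-piece). -/
def aA : Atom ι κ := Sum.inr (Sum.inl 1)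

/-- The atom `P` (the dropped piece). -/
def pA : Atom ι κ := Sum.inr (Sum.inl 2)

section Defs

variable (p : Pt ι κ)

/-- The red edge set of a point. -/
def ER : Set (Atom ι κ) :=
  (Sum.inl '' {j | p.1 j = true}) ∪ {x | x = uA ∧ ∃ j, p.1 j = true} ∪ {x | x = aA ∧ p.2.1 = true} ∪
    {x | x = pA ∧ (∃ j, p.1 j = true) ∧ p.2.2.1 = true} ∪
    ((fun k => (Sum.inr (Sum.inr k) : Atom ι κ)) '' {k | p.2.2.2.2 k = true})

/-- The total flip of a point. -/
def flipPt : Pt ι κ := (flipAll p.1, !p.2.1, !p.2.2.1, !p.2.2.2.1, flipAll p.2.2.2.2)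

/-- The blue edge set: the red edge set of the flipped point. -/
def EB : Set (Atom ι κ) := ER (flipPt p)

/-- The leaking points: `P` in the hull with its outside edges of the hull's colour. -/
def Leak : Prop :=
  ((∃ j, p.1 j = true) ∧ p.2.2.1 = true ∧ p.2.2.2.1 = false) ∨
    ((∃ j, p.1 j = false) ∧ p.2.2.1 = false ∧ p.2.2.2.1 = true)

/-- The canonical points: the u–P edges red iff the outside edges of `P` are blue. -/
def C0 : Prop := p.2.2.1 = p.2.2.2.1

/-- The escaping points: `u`'s arms all of one colour `t`, `P` attached by edges of colour `t`, its
outside edges of colour `t`. -/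
def D : Prop := p.1 = (fun _ => p.2.2.2.1) ∧ p.2.2.1 = !p.2.2.2.1

end Defs

/-- The property `G4`: at `s = ⊥` and `e = false` the conditioning does not depend on `uP`. -/
def G4 (Q : Set (Pt ι κ)) : Prop :=
  ∀ (a : Bool) (f : Config κ), ((fun _ => false), a, false, false, f) ∈ Q ↔
    ((fun _ => false), a, true, false, f) ∈ Q

section Basic

omit [Fintype ι] [DecidableEq ι] [Fintype κ] [DecidableEq κ] in
/-- A colouring with no red coordinate is the all-blue colouring. -/
lemma eq_const_false_iff (s : Config ι) : (∀ j, s j = false) ↔ s = fun _ => false := by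
  constructor
  · intro h; funext j; exact h j
  · intro h j; exact congrFun h j

omit [Fintype ι] [DecidableEq ι] [Fintype κ] [DecidableEq κ] in
/-- A colouring with no blue coordinate is the all-red colouring. -/
lemma eq_const_true_iff (s : Config ι) : (∀ j, s j = true) ↔ s = fun _ => true := by
  constructor
  · intro h; funext j; exact h j
  · intro h j; exact congrFun h j

omit [Fintype ι] [DecidableEq ι] [Fintype κ] [DecidableEq κ] in
/-- Not leaking is being canonical or escaping. -/
lemma not_leak_iff (p : Pt ι κ) : ¬ Leak p ↔ C0 p ∨ D p := by
  obtain ⟨s, a, uP, e, f⟩ := p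
  cases uP <;> cases e
  · simp [Leak, C0, D]
  · simp [Leak, C0, D, eq_const_true_iff]
  · simp [Leak, C0, D, eq_const_false_iff]
  · simp [Leak, C0, D]

omit [Fintype ι] [DecidableEq ι] [Fintype κ] [DecidableEq κ] in
/-- Canonical and escaping exclude each other. -/
lemma not_C0_and_D (p : Pt ι κ) : ¬ (C0 p ∧ D p) := by
  rintro ⟨h1, _, h2⟩
  rw [C0] at h1
  rw [h1] at h2
  cases p.2.2.2.1 <;> simp at h2

omit [Fintype ι] [DecidableEq ι] [Fintype κ] [DecidableEq κ] in
/-- `true ≤ b` forces `b = true`. -/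
lemma true_le_imp {b b' : Bool} (h : b ≤ b') (hb : b = true) : b' = true := by
  subst hb
  cases b'
  · exact absurd h (by decide)
  · rfl

omit [Fintype ι] [DecidableEq ι] [Fintype κ] [DecidableEq κ] in
/-- The red edge set is monotone. -/
lemma ER_mono {p q : Pt ι κ} (h : p ≤ q) : ER p ⊆ ER q := by
  obtain ⟨hs, ha, huP, _, hf⟩ := h
  intro x hx
  simp only [ER, Set.mem_union, Set.mem_image, Set.mem_setOf_eq] at hx ⊢
  rcases hx with ((((⟨j, hj, rfl⟩ | ⟨rfl, j, hj⟩) | ⟨rfl, hp⟩) | ⟨rfl, ⟨j, hj⟩, hp⟩) | ⟨k, hk, rfl⟩)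
  · exact Or.inl (Or.inl (Or.inl (Or.inl ⟨j, true_le_imp (hs j) hj, rfl⟩)))
  · exact Or.inl (Or.inl (Or.inl (Or.inr ⟨rfl, j, true_le_imp (hs j) hj⟩)))
  · exact Or.inl (Or.inl (Or.inr ⟨rfl, true_le_imp ha hp⟩))
  · exact Or.inl (Or.inr ⟨rfl, ⟨j, true_le_imp (hs j) hj⟩, true_le_imp huP hp⟩)
  · exact Or.inr ⟨k, true_le_imp (hf k) hk, rfl⟩

omit [Fintype ι] [DecidableEq ι] [Fintype κ] [DecidableEq κ] in
/-- The total flip is an involution. -/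
lemma flipPt_flipPt (p : Pt ι κ) : flipPt (flipPt p) = p := by
  obtain ⟨s, a, uP, e, f⟩ := p
  simp only [flipPt, flipAll_involutive s, flipAll_involutive f, Bool.not_not]

end Basic

section Canonical

/-- The canonical embedding `(s, a, e, f) ↦ (s, a, e, e, f)`. -/
def canon (x : Config (ι ⊕ (Fin 2 ⊕ κ))) : Pt ι κ :=
  (fun j => x (Sum.inl j), x (Sum.inr (Sum.inl 0)), x (Sum.inr (Sum.inl 1)), x (Sum.inr (Sum.inl 1)),
    fun k => x (Sum.inr (Sum.inr k)))

omit [Fintype ι] [DecidableEq ι] [Fintype κ] [DecidableEq κ] in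
/-- `canon` is injective. -/
lemma canon_injective : Function.Injective (canon : Config (ι ⊕ (Fin 2 ⊕ κ)) → Pt ι κ) := by
  intro x y h
  simp only [canon, Prod.mk.injEq] at h
  obtain ⟨hs, ha, he, _, hf⟩ := h
  funext z
  rcases z with j | (i | k)
  · exact congrFun hs j
  · fin_cases i
    · exact ha
    · exact he
  · exact congrFun hf k

omit [Fintype ι] [DecidableEq ι] [Fintype κ] [DecidableEq κ] in
/-- `canon` is monotone. -/
lemma canon_mono {x y : Config (ι ⊕ (Fin 2 ⊕ κ))} (h : x ≤ y) : canon x ≤ canon y :=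
  ⟨fun _ => h _, h _, h _, h _, fun _ => h _⟩

omit [Fintype ι] [DecidableEq ι] [Fintype κ] [DecidableEq κ] in
/-- The image of `canon` is the set of canonical points. -/
lemma canon_range (p : Pt ι κ) : C0 p ↔ ∃ x, canon x = p := by
  constructor
  · intro h
    refine ⟨Sum.elim p.1 (Sum.elim ![p.2.1, p.2.2.1] p.2.2.2.2), ?_⟩
    obtain ⟨s, a, uP, e, f⟩ := p
    simp only [C0] at h
    simp only [canon, Sum.elim_inl, Sum.elim_inr, Matrix.cons_val_zero, Matrix.cons_val_one,
      Prod.mk.injEq, true_and]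
    exact ⟨h, trivial⟩
  · rintro ⟨x, rfl⟩
    rfl

omit [Fintype ι] [DecidableEq ι] [Fintype κ] [DecidableEq κ] in
/-- The flip of a canonical point is canonical. -/
lemma flipPt_canon (x : Config (ι ⊕ (Fin 2 ⊕ κ))) : flipPt (canon x) = canon (flipAll x) := rfl

end Canonical

section Escaping

/-- The escaping embedding `(t, a, f) ↦ (const t, a, !t, t, f)`. -/
def esc (y : Config (Fin 2 ⊕ κ)) : Pt ι κ :=
  (fun _ => y (Sum.inl 0), y (Sum.inl 1), !(y (Sum.inl 0)), y (Sum.inl 0), fun k => y (Sum.inr k))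

omit [Fintype ι] [DecidableEq ι] [Fintype κ] [DecidableEq κ] in
/-- `esc` is injective. -/
lemma esc_injective : Function.Injective (esc : Config (Fin 2 ⊕ κ) → Pt ι κ) := by
  intro x y h
  simp only [esc, Prod.mk.injEq] at h
  obtain ⟨_, ha, _, ht, hf⟩ := h
  funext z
  rcases z with i | k
  · fin_cases i
    · exact ht
    · exact ha
  · exact congrFun hf k

omit [Fintype ι] [DecidableEq ι] [Fintype κ] [DecidableEq κ] in
/-- The image of `esc` is the set of escaping points. -/
lemma esc_range (p : Pt ι κ) : D p ↔ ∃ y, esc y = p := by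
  constructor
  · intro h
    refine ⟨Sum.elim ![p.2.2.2.1, p.2.1] p.2.2.2.2, ?_⟩
    obtain ⟨s, a, uP, e, f⟩ := p
    obtain ⟨hs, huP⟩ := h
    simp only at hs huP
    simp only [esc, Sum.elim_inl, Sum.elim_inr, Matrix.cons_val_zero, Matrix.cons_val_one,
      Prod.mk.injEq, and_true, true_and]
    exact ⟨hs.symm, huP.symm⟩
  · rintro ⟨y, rfl⟩
    exact ⟨rfl, rfl⟩

omit [Fintype ι] [DecidableEq ι] [Fintype κ] [DecidableEq κ] in
/-- The flip of an escaping point is the escaping point of the flipped coordinates. -/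
lemma flipPt_esc (y : Config (Fin 2 ⊕ κ)) : flipPt (esc y : Pt ι κ) = esc (flipAll y) := by
  simp only [flipPt, esc, flipAll, Bool.not_not]
  rfl

omit [Fintype ι] [DecidableEq ι] [Fintype κ] [DecidableEq κ] in
/-- The red edge set of an escaping point never contains `P`, and is monotone in `(t, a, f)`. -/
lemma ER_esc_mono {y y' : Config (Fin 2 ⊕ κ)} (h : y ≤ y') : ER (esc y : Pt ι κ) ⊆ ER (esc y') := by
  intro x hx
  simp only [ER, esc, Set.mem_union, Set.mem_image, Set.mem_setOf_eq] at hx ⊢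
  rcases hx with ((((⟨j, hj, rfl⟩ | ⟨rfl, j, hj⟩) | ⟨rfl, hp⟩) | ⟨rfl, ⟨j, hj⟩, hp⟩) | ⟨k, hk, rfl⟩)
  · exact Or.inl (Or.inl (Or.inl (Or.inl ⟨j, true_le_imp (h (Sum.inl 0)) hj, rfl⟩)))
  · exact Or.inl (Or.inl (Or.inl (Or.inr ⟨rfl, j, true_le_imp (h (Sum.inl 0)) hj⟩)))
  · exact Or.inl (Or.inl (Or.inr ⟨rfl, true_le_imp (h (Sum.inl 1)) hp⟩))
  · exfalso
    rw [hj] at hp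
    exact absurd hp (by decide)
  · exact Or.inr ⟨k, true_le_imp (h (Sum.inr k)) hk, rfl⟩

omit [Fintype ι] [DecidableEq ι] [Fintype κ] [DecidableEq κ] in
/-- Under `G4`, the pull-back of a lower set along `esc` is a lower set. -/
lemma esc_preimage_isLowerSet {Q : Set (Pt ι κ)} (hQ : IsLowerSet Q) (hG : G4 Q) :
    IsLowerSet {y : Config (Fin 2 ⊕ κ) | esc y ∈ Q} := by
  intro y y' hle hy
  simp only [Set.mem_setOf_eq] at hy ⊢
  have ha : y' (Sum.inl 1) ≤ y (Sum.inl 1) := hle _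
  have hf : ∀ k, y' (Sum.inr k) ≤ y (Sum.inr k) := fun k => hle _
  have ht := hle (Sum.inl 0)
  cases hy0 : y (Sum.inl 0) <;> cases hy0' : y' (Sum.inl 0)
  · -- t = t' = false
    apply hQ _ hy
    refine ⟨fun _ => ?_, ha, ?_, ?_, hf⟩
    · simp only [esc, hy0, hy0']; exact le_refl _
    · simp only [esc, hy0, hy0']; exact le_refl _
    · simp only [esc, hy0, hy0']; exact le_refl _
  · -- t = false, t' = true: impossible
    exfalso
    have := true_le_imp ht hy0'
    rw [hy0] at this
    exact absurd this (by decide)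
  · -- t = true, t' = false: through `G4`
    have key : ((fun _ => false), y' (Sum.inl 1), false, false, fun k => y' (Sum.inr k)) ∈ Q := by
      apply hQ _ hy
      refine ⟨fun _ => ?_, ha, ?_, ?_, hf⟩
      · simp only [esc, hy0]; exact Bool.false_le _
      · simp only [esc, hy0, Bool.not_true]; exact le_refl _
      · simp only [esc, hy0]; exact Bool.false_le _
    have := (hG (y' (Sum.inl 1)) (fun k => y' (Sum.inr k))).1 key
    simp only [esc, hy0', Bool.not_false]
    exact this
  · -- t = t' = true
    apply hQ _ hy
    refine ⟨fun _ => ?_, ha, ?_, ?_, hf⟩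
    · simp only [esc, hy0, hy0']; exact le_refl _
    · simp only [esc, hy0, hy0']; exact le_refl _
    · simp only [esc, hy0, hy0']; exact le_refl _

end Escaping

end BigBlock

end Summit.Ventures.PercRepro2
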